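import Literature.Topology.FourManifolds.HCobordismBasisTheorem
import Literature.Topology.FourManifolds.HCobordismIndexZeroOneProofs
import Literature.Topology.FourManifolds.HCobordismTradeIndexOneProofs
import Literature.Topology.FourManifolds.HCobordismLevelConnectivityProofs
import Literature.Topology.FourManifolds.DisjointSpheresSlab
import Literature.Topology.FourManifolds.RearrangementSlabProofs
import Literature.Topology.FourManifolds.GradientLikeExistence
import Literature.Topology.FourManifolds.CobordismMorseFunctions
import Literature.AlgebraicTopology.SingularHomology.LocalHomologyVanishing
import HarnessLib

/-!
# Wall 1964, Lemma 2, Morse-theoretic route: the handles of the cobordism `K` — only 2- and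
# 3-handles from the bottom, the 2-handles realising `H₂`, and the acyclic top part

Topic `Literature/Topology/FourManifolds` (fact seat
`provefact-Literature.Topology.FourManifolds.exists-68ee520c9a`, Wall 1964, Lemma 2,
`WallBoundingHandlebody.lean`; items 2–5 of the route recorded there).  Everything here is
**proved**, GIVEN Milnor's Basis Theorem 7.6 on a slab (the tree's named fact
`Cobordism.Milnor1965_basisTheorem_slab`, a hypothesis throughout); no named facts are
introduced.

Setting: a 5-dimensional cobordism `d = (K; V, P)` (`Cobordism 4 V P`) with `K` and `V` simply
connected, `H₀(K, V) = 0`, and `Hᵢ(K, V; ℤ)` zero for `i ≠ 2` and free of rank `k` for `i = 2`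
(in the application, `K = W − D̊⁵` cut off below `M`, `V = 𝕊⁴`, and `k = rank H₂(W)`,
`WallHandlebodySlab.lean`, `WallHandlebodyHomology.lean`).  The conclusion
(`Cobordism.exists_isMorseFunction_sublevel_acyclic`): a Morse function `g` on `d` all of whose
critical points have index `≥ 2`, and a non-critical level `m` such that the critical points
below `m` are exactly `k` points of index `2` and the top part is acyclic relative to the
level, `H⁎({g ≤ 1}, {g ≤ m}; ℤ) = 0`.  Milnor, *Lectures on the h-cobordism theorem* (1965):

1. *(§8)* Thm. 2.5 gives a Morse function; Thm. 8.1 Index 0 cancels its critical points of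
   index `0` (`H₀(K, V) = 0`) and Index 1 trades those of index `1` (`K`, `V` simply connected,
   `dim K = 5`) — the tree's discharged `Cobordism.Milnor1965_cancel_index_zero_holds`,
   `Cobordism.Milnor1965_trade_index_one_holds`; Thm. 4.8 makes it nice
   (`Cobordism.Milnor1965_finalRearrangement_holds`).
2. *(§7, PDF pp. 46–49)* For the nice `g` with indices in `{2, …, 5}`: `H⁎(K^{t₀}, V) = 0`
   below the index-2 slab, `C₂ = H₂(K^{t₁}, K^{t₀})` is free on the index-2 points (Cor. 3.15,
   `Cobordism.Milnor1965_homology_oneLevel_slab_holds`), `H⁎(K, K^{t₁})` vanishes in degrees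
   `≤ 2` (only handles of index `≥ 3` above), so `C₂ → H₂(K, K^{t₀}) ≅ H₂(K, V) ≅ ℤᵏ` is onto
   (exact sequences of triples, Hatcher p. 118); choose an adapted basis of `C₂` — kernel
   vectors first, lifts of a basis of `H₂(K, V)` last (the linear algebra of PDF p. 53,
   `exists_basis_map_natAdd_eq`).
3. *(Thm. 7.6)* The Basis Theorem on the index-2 slab (`2 ≤ λ = 2 ≤ dim K - 2 = 3`; the slab is
   connected, indeed simply connected, by Thm. 3.14 / PDF p. 56 as the tree's
   `Cobordism.isSimplyConnected_slab_left`) realises this basis by left-hand discs; *(Thms.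
   4.1/4.2 on the slab, `Cobordism.Milnor1965_rearrangement_slab_holds`)* the `k` "homological"
   points are then lowered to a level `α` below the level `β` of the kernel points (the
   `K`-sets of points on one level are disjoint), and `m` is taken between `α` and `β`.
4. *(Conclusion, exact sequence of the triple `K^{t₀} ⊆ K^m ⊆ K`)* the left-hand discs of the
   lowered points lie in `K^m` and their classes map onto the chosen basis of
   `H₂(K, K^{t₀})`; `H₂(K^m, K^{t₀})` being free of the same rank `k` (Cor. 3.15 again) the map
   `H⁎(K^m, K^{t₀}) → H⁎(K, K^{t₀})` is an isomorphism in every degree, whence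
   `H⁎(K, K^m) = 0`.

This replaces, for Wall's `W` (where only `k` of the 2-handles are wanted and the 3-handles
cannot be cancelled in dimension `5`), the cancellation of Thm. 7.8: the homological 2-handles
form the handlebody, everything above them is an acyclic — as it will turn out, h- —
cobordism (Wall 1964, proof of Lemma 2: "the inclusion of `H` in `W` is a homology
equivalence … `Hᵢ(C, ∂H) = 0`").

## References

* C. T. C. Wall, *On simply-connected 4-manifolds*, J. London Math. Soc. 39 (1964), Lemma 2
  (pp. 143–144). [WallJLMS1964]
* J. Milnor, *Lectures on the h-cobordism theorem* (1965), Thm. 2.5, Cor. 3.15, Thms. 4.1,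
  4.2, 4.8, Thm. 7.6, PDF pp. 46–53, Thm. 8.1 (PDF pp. 54–57). [MilnorHCobordism1965]
* A. Hatcher, *Algebraic Topology* (2002), §2.1, p. 118. [HatcherAT2002]
-/

open scoped Manifold ContDiff Topology
open Set Function Filter CategoryTheory CategoryTheory.Limits
open Literature.AlgebraicTopology.SingularHomology

noncomputable section

universe u

namespace Literature.Topology.FourManifolds

/-- Local notation: `𝔼 n` is the model Euclidean space `EuclideanSpace ℝ (Fin n)`. -/
local notation "𝔼 " n:arg => EuclideanSpace ℝ (Fin n)

/-! ### Exact-sequence lemmas for the sublevel filtration -/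

section Triple

variable {X : Type u} [TopologicalSpace X] (g : X → ℝ)

/-- **If `H⁎(W^b, W^a) = 0` then `Hᵢ₊₁(W^c, W^a) → Hᵢ₊₁(W^c, W^b)` is an isomorphism** (exact
sequence of the triple `W^a ⊆ W^b ⊆ W^c`, Hatcher p. 118; positive degrees). [cite: HatcherAT2002, §2.1, p. 118 (exact sequence of a triple)] -/
theorem isIso_sublevelRelax_succ_of_isZero {a b c : ℝ} (hab : a ≤ b) (hbc : b ≤ c)
    (h : ∀ i, IsZero (sublevelHomology g a b i)) (i : ℕ) :
    IsIso (sublevelRelax g hab c (i + 1)) := by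
  haveI : Mono (sublevelRelax g hab c (i + 1)) :=
    (sublevel_exact₂ g hab hbc (i + 1)).mono_g ((h (i + 1)).eq_of_src _ _)
  haveI : Epi (sublevelRelax g hab c (i + 1)) :=
    (sublevel_exact₃ g hab hbc i).epi_f ((h i).eq_of_tgt _ _)
  exact isIso_of_mono_of_epi _

/-- **If `H⁎(W^c, W^b) = 0` then `H⁎(W^b, W^a) → H⁎(W^c, W^a)` is an isomorphism** (exact
sequence of the triple, all degrees). [cite: HatcherAT2002, §2.1, p. 118 (exact sequence of a triple)] -/
theorem isIso_sublevelMap_of_isZero {a b c : ℝ} (hab : a ≤ b) (hbc : b ≤ c)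
    (h : ∀ i, IsZero (sublevelHomology g b c i)) (i : ℕ) : IsIso (sublevelMap g a hbc i) := by
  haveI : Mono (sublevelMap g a hbc i) :=
    (sublevel_exact₁ g hab hbc i).mono_g ((h (i + 1)).eq_of_src _ _)
  haveI : Epi (sublevelMap g a hbc i) :=
    (sublevel_exact₂ g hab hbc i).epi_f ((h i).eq_of_tgt _ _)
  exact isIso_of_mono_of_epi _

/-- **If `Hᵢ(W^b, W^a) = Hᵢ(W^c, W^b) = 0` then `Hᵢ(W^c, W^a) = 0`** (exactness at the middle
term). [cite: HatcherAT2002, §2.1, p. 118 (exact sequence of a triple)] -/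
theorem isZero_sublevelHomology_of_isZero_of_isZero {a b c : ℝ} (hab : a ≤ b) (hbc : b ≤ c)
    {i : ℕ} (h₁ : IsZero (sublevelHomology g a b i)) (h₂ : IsZero (sublevelHomology g b c i)) :
    IsZero (sublevelHomology g a c i) :=
  (sublevel_exact₂ g hab hbc i).isZero_of_both_zeros (h₁.eq_of_src _ _) (h₂.eq_of_tgt _ _)

/-- **If `H⁎(W^b, W^a) → H⁎(W^c, W^a)` is an isomorphism in every degree then
`H⁎(W^c, W^b) = 0`** (exact sequence of the triple: the map into `Hᵢ(W^c, W^b)` is zero since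
the map before it is onto, and the boundary map out of it is zero since the map after it is
one-to-one; degree `0` by the surjectivity of `H₀(W^c, W^a) → H₀(W^c, W^b)`).
[cite: HatcherAT2002, §2.1, p. 118 (exact sequence of a triple)] -/
theorem isZero_sublevelHomology_of_isIso_sublevelMap {a b c : ℝ} (hab : a ≤ b) (hbc : b ≤ c)
    (h : ∀ i, IsIso (sublevelMap g a hbc i)) (i : ℕ) : IsZero (sublevelHomology g b c i) := by
  have hrel : ∀ j, sublevelRelax g hab c j = 0 := fun j => by
    haveI := h j
    have h0 := (ShortComplex.mk _ _ (sublevelMap_comp_sublevelRelax g hab hbc j)).zero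
    change sublevelMap g a hbc j ≫ sublevelRelax g hab c j = 0 at h0
    rwa [← cancel_epi (sublevelMap g a hbc j), comp_zero]
  cases i with
  | zero =>
    -- `H₀(W^c, W^a) → H₀(W^c, W^b)` is onto (both receive `H₀(W^c)` surjectively)
    haveI := relativeSingularHomology.epi_ofAbsolute_zero ℤ ℤ
      (X := ↥{z : X | g z ≤ c}) {z | g z.1 ≤ b}
    have hfac : relativeSingularHomology.ofAbsolute ℤ ℤ (↥{z : X | g z ≤ c}) {z | g z.1 ≤ a} 0 ≫
        sublevelRelax g hab c 0 =
          relativeSingularHomology.ofAbsolute ℤ ℤ (↥{z : X | g z ≤ c}) {z | g z.1 ≤ b} 0 := by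
      rw [sublevelRelax, relativeSingularHomology.ofAbsolute_comp_map, singularHomology.map_id,
        Category.id_comp]
    haveI : Epi (sublevelRelax g hab c 0) := epi_of_epi_fac hfac
    exact IsZero.of_epi_eq_zero (sublevelRelax g hab c 0) (hrel 0)
  | succ i =>
    have hbd : sublevelBoundary g a b c i = 0 := by
      haveI := h i
      have h0 := (ShortComplex.mk _ _ (sublevelBoundary_comp_sublevelMap g hab hbc i)).zero
      change sublevelBoundary g a b c i ≫ sublevelMap g a hbc i = 0 at h0
      rwa [← cancel_mono (sublevelMap g a hbc i), zero_comp]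
    exact (sublevel_exact₃ g hab hbc i).isZero_of_both_zeros (hrel (i + 1)) hbd

end Triple

/-! ### Milnor's §8 on `K`: a nice Morse function with handles of index `≥ 2` only -/

section LowHandles

variable {V P : Type u} [TopologicalSpace V] [T2Space V] [SecondCountableTopology V]
  [ChartedSpace (𝔼 4) V] [IsManifold (𝓡 4) ∞ V] [CompactSpace V]
  [TopologicalSpace P] [T2Space P] [SecondCountableTopology P] [ChartedSpace (𝔼 4) P]
  [IsManifold (𝓡 4) ∞ P] [CompactSpace P]

/-- **Milnor 1965, Thm. 2.5, Thm. 8.1 and Thm. 4.8 on a 5-dimensional cobordism `(K; V, P)`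
with `K`, `V` simply connected and `H₀(K, V) = 0`: a nice Morse function all of whose critical
points have index `≥ 2`** — cancel the critical points of index `0`
(`Cobordism.Milnor1965_cancel_index_zero_holds`), trade those of index `1`
(`Cobordism.Milnor1965_trade_index_one_holds`, `dim K = 5`), make the result nice
(`Cobordism.Milnor1965_finalRearrangement_holds`).
[cite: MilnorHCobordism1965, Thm. 2.5 (PDF p. 6), Thm. 8.1 (PDF pp. 54–57), Thm. 4.8 (PDF p. 25)] -/
theorem Cobordism.exists_isNiceMorseFunction_two_le_index (d : Cobordism 4 V P)
    [SimplyConnectedSpace d.W] [SimplyConnectedSpace V] (hH0 : ∀ z : d.W, ∃ x, Joined z (d.inl x)) :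
    ∃ g : d.W → ℝ, d.IsNiceMorseFunction g ∧
      ∀ z ∈ criticalSet (𝓡∂ (4 + 1)) g, 2 ≤ morseIndex (𝓡∂ (4 + 1)) g z := by
  obtain ⟨g₀, hg₀⟩ := Cobordism.exists_isMorseFunction_holds (n := 4) (M := V) (N := P) d
  obtain ⟨g₁, hg₁, h0₁, -, -, -⟩ := Cobordism.Milnor1965_cancel_index_zero_holds d hH0 g₀ hg₀
  obtain ⟨g₂, hg₂, h1₂, -, -, hk₂⟩ :=
    Cobordism.Milnor1965_trade_index_one_holds le_rfl d inferInstance inferInstance g₁ hg₁ h0₁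
  have h0₂ : criticalSetOfIndex (𝓡∂ (4 + 1)) g₂ 0 = ∅ := by
    rw [hk₂ 0 (by norm_num) (by norm_num), h0₁]
  obtain ⟨g, hg, hcrit, hind⟩ := Cobordism.Milnor1965_finalRearrangement_holds hg₂
  refine ⟨g, hg, fun z hz => ?_⟩
  have hz₂ : z ∈ criticalSet (𝓡∂ (4 + 1)) g₂ := by rw [← hcrit]; exact hz
  rw [hind z hz₂]
  exact two_le_morseIndex_of_criticalSetOfIndex_zero_one_eq_empty h0₂ h1₂ hz₂

end LowHandles

/-! ### The sublevel filtration of a nice function with handles of index `≥ 2` (`dim K = 5`) -/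

/-- `H₀(W^c, W^a) → H₀(W^c, W^b)` is onto (both receive `H₀(W^c)` surjectively). [cite: HatcherAT2002, §2.1, p. 118] -/
theorem epi_sublevelRelax_zero {X : Type u} [TopologicalSpace X] (g : X → ℝ) {a b : ℝ} (hab : a ≤ b)
    (c : ℝ) : Epi (sublevelRelax g hab c 0) := by
  haveI := relativeSingularHomology.epi_ofAbsolute_zero ℤ ℤ (X := ↥{z : X | g z ≤ c}) {z | g z.1 ≤ b}
  have hfac : relativeSingularHomology.ofAbsolute ℤ ℤ (↥{z : X | g z ≤ c}) {z | g z.1 ≤ a} 0 ≫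
      sublevelRelax g hab c 0 =
        relativeSingularHomology.ofAbsolute ℤ ℤ (↥{z : X | g z ≤ c}) {z | g z.1 ≤ b} 0 := by
    rw [sublevelRelax, relativeSingularHomology.ofAbsolute_comp_map, singularHomology.map_id,
      Category.id_comp]
  exact epi_of_epi_fac hfac

section Filtration

variable {V P : Type u} [TopologicalSpace V] [T2Space V] [SecondCountableTopology V]
  [ChartedSpace (𝔼 4) V] [IsManifold (𝓡 4) ∞ V] [CompactSpace V]
  [TopologicalSpace P] [T2Space P] [SecondCountableTopology P] [ChartedSpace (𝔼 4) P]
  [IsManifold (𝓡 4) ∞ P] [CompactSpace P]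

namespace Cobordism.IsNiceMorseFunction

variable {d : Cobordism 4 V P} {g : d.W → ℝ} (hg : d.IsNiceMorseFunction g)
  (h2 : ∀ z ∈ criticalSet (𝓡∂ (4 + 1)) g, 2 ≤ morseIndex (𝓡∂ (4 + 1)) g z)
include hg h2

omit [T2Space V] [SecondCountableTopology V] [IsManifold (𝓡 4) ∞ V] [CompactSpace V] [T2Space P]
  [SecondCountableTopology P] [IsManifold (𝓡 4) ∞ P] [CompactSpace P] in
/-- The critical values of a nice function with indices `≥ 2` lie above `cutLevel 4 2`.
[cite: MilnorHCobordism1965, Def. 4.9 (PDF p. 25)] -/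
theorem cutLevel_two_lt_apply {z : d.W} (hz : z ∈ criticalSet (𝓡∂ (4 + 1)) g) :
    Cobordism.cutLevel 4 2 < g z := by
  rw [hg.2 z hz]
  exact (Cobordism.cutLevel_lt_niceLevel 4 2).trans_le
    ((Cobordism.niceLevel_strictMono 4).monotone (h2 z hz))

/-- **`H⁎(K^{t₀}, V) = 0` below the index-2 slab** (`t₀ = cutLevel 4 2`; no critical point has
value `≤ t₀`; Cor. 3.15 / Thm. 3.4 in the vacuous case). [cite: MilnorHCobordism1965, Cor. 3.15 and Thm. 3.4 (PDF pp. 12, 19)] -/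
theorem isZero_sublevelHomology_zero_cutLevel_two (i : ℕ) :
    IsZero (sublevelHomology g 0 (Cobordism.cutLevel 4 2) i) := by
  have ht0 : 0 < Cobordism.cutLevel 4 2 := by
    have := Cobordism.cutLevel_strictMono 4 (show 0 < 2 by norm_num)
    rwa [Cobordism.cutLevel_zero] at this
  have ht1 : Cobordism.cutLevel 4 2 ≤ 1 := by
    have := Cobordism.cutLevel_mono 4 (show 2 ≤ 4 + 2 by norm_num)
    rwa [Cobordism.cutLevel_eq_one] at this
  have h := (Cobordism.Milnor1965_homology_oneLevel_slab_holds hg.1 le_rfl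
    (show (0 : ℝ) < Cobordism.cutLevel 4 2 / 2 by linarith)
    (show Cobordism.cutLevel 4 2 / 2 < Cobordism.cutLevel 4 2 by linarith) ht1 (k := i + 1)
    (fun z hz hzI => absurd hzI.2 (not_le.2 (cutLevel_two_lt_apply hg h2 hz)))).1
  exact h i (by omega)

omit h2 in
/-- **`Hᵢ(K, K^{t₁}) = 0` for `i ≤ 2` above the index-2 slab** (`t₁ = cutLevel 4 3`): the slabs
`c₃`, `c₄`, `c₅` of the nice function have homology concentrated in degrees `3`, `4`, `5`
(Cor. 3.15 with the Remark after Thm. 3.14), and the exact sequences of the triples combine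
them. [cite: MilnorHCobordism1965, Cor. 3.15 and Remark after Thm. 3.14 (PDF pp. 19–21), PDF p. 48] -/
theorem isZero_sublevelHomology_cutLevel_three_one {i : ℕ} (hi : i ≤ 2) :
    IsZero (sublevelHomology g (Cobordism.cutLevel 4 3) 1 i) := by
  -- one-level slabs `[cutLevel j, cutLevel (j + 1)]`, `j = 3, 4, 5`
  have hslab : ∀ j, 3 ≤ j → j ≤ 5 → IsZero (sublevelHomology g (Cobordism.cutLevel 4 j)
      (Cobordism.cutLevel 4 (j + 1)) i) := by
    intro j hj3 hj5
    have h0 : 0 ≤ Cobordism.cutLevel 4 j := by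
      have := Cobordism.cutLevel_mono 4 (Nat.zero_le j)
      rwa [Cobordism.cutLevel_zero] at this
    have h1 : Cobordism.cutLevel 4 (j + 1) ≤ 1 := by
      have := Cobordism.cutLevel_mono 4 (show j + 1 ≤ 4 + 2 by omega)
      rwa [Cobordism.cutLevel_eq_one] at this
    have h := (Cobordism.Milnor1965_homology_oneLevel_slab_holds hg.1 h0
      (Cobordism.cutLevel_lt_niceLevel 4 j) (Cobordism.niceLevel_lt_cutLevel_succ 4 j) h1 (k := j)
      (fun z hz hzI => hg.eq_of_apply_mem_Icc_cutLevel hz hzI)).1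
    exact h i (by omega)
  have h34 := hslab 3 le_rfl (by norm_num)
  have h45 := hslab 4 (by norm_num) (by norm_num)
  have h56 := hslab 5 (by norm_num) le_rfl
  rw [show (5 : ℕ) + 1 = 4 + 2 from rfl, Cobordism.cutLevel_eq_one] at h56
  have h35 : IsZero (sublevelHomology g (Cobordism.cutLevel 4 3) (Cobordism.cutLevel 4 5) i) :=
    isZero_sublevelHomology_of_isZero_of_isZero g (Cobordism.cutLevel_mono 4 (by norm_num))
      (Cobordism.cutLevel_mono 4 (by norm_num)) h34 h45
  have h51 : Cobordism.cutLevel 4 5 ≤ 1 := by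
    have := Cobordism.cutLevel_mono 4 (show 5 ≤ 4 + 2 by norm_num)
    rwa [Cobordism.cutLevel_eq_one] at this
  exact isZero_sublevelHomology_of_isZero_of_isZero g (Cobordism.cutLevel_mono 4 (by norm_num))
    h51 h35 h56

/-- **`Hᵢ₊₁(K, V) ≅ Hᵢ₊₁(K, K^{t₀})`** in positive degrees (the collar below the index-2 slab
carries no homology). [cite: HatcherAT2002, §2.1, p. 118] [cite: MilnorHCobordism1965, Cor. 3.15] -/
theorem isIso_sublevelRelax_zero_cutLevel_two (i : ℕ) :
    IsIso (sublevelRelax g (le_of_lt (by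
      have := Cobordism.cutLevel_strictMono 4 (show 0 < 2 by norm_num)
      rwa [Cobordism.cutLevel_zero] at this : (0 : ℝ) < Cobordism.cutLevel 4 2)) 1 (i + 1)) :=
  isIso_sublevelRelax_succ_of_isZero g _ (by
    have := Cobordism.cutLevel_mono 4 (show 2 ≤ 4 + 2 by norm_num)
    rwa [Cobordism.cutLevel_eq_one] at this) (isZero_sublevelHomology_zero_cutLevel_two hg h2) i

omit [T2Space V] [SecondCountableTopology V] [IsManifold (𝓡 4) ∞ V] [CompactSpace V] [T2Space P]
  [SecondCountableTopology P] [IsManifold (𝓡 4) ∞ P] [CompactSpace P] h2 in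
/-- **`{g ≤ 0} = inl(V)`** for a Morse function on a cobordism (`g ≥ 0`, `g⁻¹(0) = inl(V)`).
[cite: MilnorHCobordism1965, Def. 3.1] -/
theorem setOf_le_zero_eq : {z : d.W | g z ≤ 0} = range d.inl := by
  rw [← hg.1.preimage_zero]
  ext z
  simp only [mem_setOf_eq, mem_preimage, mem_singleton_iff]
  exact ⟨fun h => le_antisymm h (hg.1.mem_Icc z).1, fun h => h.le⟩

/-- **`H⁎(K, V)` read in the sublevel filtration**: `Hᵢ(K, inl V) ≅ Hᵢ(K^1, K^0)`.
[cite: MilnorHCobordism1965, Def. 3.1, PDF p. 48] -/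
def relIsoSublevelZeroOne (i : ℕ) :
    relativeSingularHomology ℤ ℤ d.W (range d.inl) i ≅ sublevelHomology g 0 1 i := by
  have e := (sublevelHomologyTopIso g 0 (fun z => (hg.1.mem_Icc z).2) i).symm
  rw [setOf_le_zero_eq hg] at e
  exact e

/-- **The homology hypotheses on `(K, V)` transported above the bottom collar**: if
`Hᵢ(K, V) = 0` for `i ≠ 2` then `Hᵢ(K^1, K^{t₀}) = 0` for `i ≠ 2`. [cite: HatcherAT2002, §2.1, p. 118] -/
theorem isZero_sublevelHomology_cutLevel_two_one
    (hzero : ∀ i, i ≠ 2 → IsZero (relativeSingularHomology ℤ ℤ d.W (range d.inl) i))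
    {i : ℕ} (hi : i ≠ 2) : IsZero (sublevelHomology g (Cobordism.cutLevel 4 2) 1 i) := by
  cases i with
  | zero =>
    haveI := epi_sublevelRelax_zero g (le_of_lt (by
      have := Cobordism.cutLevel_strictMono 4 (show 0 < 2 by norm_num)
      rwa [Cobordism.cutLevel_zero] at this : (0 : ℝ) < Cobordism.cutLevel 4 2)) 1
    exact IsZero.of_epi (sublevelRelax g _ 1 0)
      ((hzero 0 (by norm_num)).of_iso (relIsoSublevelZeroOne hg 0).symm)
  | succ i =>
    haveI := isIso_sublevelRelax_zero_cutLevel_two hg h2 i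
    exact ((hzero (i + 1) hi).of_iso (relIsoSublevelZeroOne hg (i + 1)).symm).of_iso
      (asIso (sublevelRelax g _ 1 (i + 1))).symm

/-- **`H₂(K^1, K^{t₀}) ≅ H₂(K, V)`**. [cite: HatcherAT2002, §2.1, p. 118] -/
def sublevelTwoIso : sublevelHomology g (Cobordism.cutLevel 4 2) 1 2 ≅
    relativeSingularHomology ℤ ℤ d.W (range d.inl) 2 :=
  haveI := isIso_sublevelRelax_zero_cutLevel_two hg h2 1
  (asIso (sublevelRelax g _ 1 (1 + 1))).symm ≪≫ (relIsoSublevelZeroOne hg 2).symm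

end Cobordism.IsNiceMorseFunction

/-! ### The homological conclusion: a rank-`k` sublevel pair hitting a basis is acyclic above -/

section Conclusion

variable {X : Type u} [TopologicalSpace X] (g : X → ℝ)

/-- **The top part is acyclic.**  Levels `t₀ ≤ mid ≤ c` with `H⁎(W^{mid}, W^{t₀})` and
`H⁎(W^c, W^{t₀})` both concentrated in degree `2` and free of the same finite rank there: if
`H₂(W^{mid}, W^{t₀}) → H₂(W^c, W^{t₀})` is onto then it is one-to-one (Orzech / rank count,
`injective_of_surjective_of_finrank_eq`), so `H⁎(W^{mid}, W^{t₀}) → H⁎(W^c, W^{t₀})` is an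
isomorphism in every degree and `H⁎(W^c, W^{mid}) = 0` by the exact sequence of the triple
(Hatcher p. 118). [cite: HatcherAT2002, §2.1, p. 118] [cite: WallJLMS1964, proof of Lemma 2 (p. 144: "by construction, the inclusion of H in W is a homology equivalence")] -/
theorem isZero_sublevelHomology_of_surjective_of_finrank_eq {t₀ mid c : ℝ} (h₀ : t₀ ≤ mid)
    (h₁ : mid ≤ c) (hA : ∀ i, i ≠ 2 → IsZero (sublevelHomology g t₀ mid i))
    [Module.Free ℤ (sublevelHomology g t₀ mid 2)] [Module.Finite ℤ (sublevelHomology g t₀ mid 2)]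
    (hX : ∀ i, i ≠ 2 → IsZero (sublevelHomology g t₀ c i))
    [Module.Free ℤ (sublevelHomology g t₀ c 2)] [Module.Finite ℤ (sublevelHomology g t₀ c 2)]
    (hrk : Module.finrank ℤ (sublevelHomology g t₀ mid 2) = Module.finrank ℤ (sublevelHomology g t₀ c 2))
    (hsurj : Function.Surjective (sublevelMap g t₀ h₁ 2).hom) :
    ∀ i, IsZero (sublevelHomology g mid c i) := by
  have hiso : ∀ i, IsIso (sublevelMap g t₀ h₁ i) := by
    intro i
    by_cases hi : i = 2
    · subst hi
      have hinj : Function.Injective (sublevelMap g t₀ h₁ 2).hom :=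
        injective_of_surjective_of_finrank_eq hrk _ hsurj
      haveI : Epi (sublevelMap g t₀ h₁ 2) := (ModuleCat.epi_iff_surjective _).2 hsurj
      haveI : Mono (sublevelMap g t₀ h₁ 2) := (ModuleCat.mono_iff_injective _).2 hinj
      exact isIso_of_mono_of_epi _
    · exact Limits.IsZero.isIso (hA i hi) (hX i hi) _
  exact isZero_sublevelHomology_of_isIso_sublevelMap g h₀ h₁ hiso

end Conclusion

/-! ### The index-2 slab is connected (indeed simply connected) -/

section Connected

variable {V P : Type u} [TopologicalSpace V] [T2Space V] [SecondCountableTopology V]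
  [ChartedSpace (𝔼 4) V] [IsManifold (𝓡 4) ∞ V] [CompactSpace V]
  [TopologicalSpace P] [T2Space P] [SecondCountableTopology P] [ChartedSpace (𝔼 4) P]
  [IsManifold (𝓡 4) ∞ P] [CompactSpace P]

/-- **The index-2 slab `g⁻¹[t₀, t₁]` of a nice function with indices `≥ 2` on a simply
connected `K` is simply connected** (Milnor 1965, PDF p. 56 via Thm. 3.14, as the tree's
`Cobordism.isSimplyConnected_slab_left`, used twice: turning the triad about, cutting off the
bottom collar `g < t₀`, which contains no critical point, does not change `π₁`; cutting off the
top `g > t₁`, which contains only critical points of index `≥ 3`, does not either).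
[cite: MilnorHCobordism1965, proof of Thm. 8.1 (PDF p. 56) and Remark 1 after Thm. 6.4 (PDF p. 38), with Thm. 3.14 (PDF pp. 19–21)] -/
theorem Cobordism.IsNiceMorseFunction.isSimplyConnected_slab_two {d : Cobordism 4 V P}
    {g : d.W → ℝ} (hg : d.IsNiceMorseFunction g)
    (h2 : ∀ z ∈ criticalSet (𝓡∂ (4 + 1)) g, 2 ≤ morseIndex (𝓡∂ (4 + 1)) g z)
    [SimplyConnectedSpace d.W] :
    IsSimplyConnected (g ⁻¹' Icc (Cobordism.cutLevel 4 2) (Cobordism.cutLevel 4 3)) := by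
  have hgM := hg.1
  set t₀ : ℝ := Cobordism.cutLevel 4 2 with ht₀d
  set t₁ : ℝ := Cobordism.cutLevel 4 3 with ht₁d
  have ht0 : 0 < t₀ := by
    have := Cobordism.cutLevel_strictMono 4 (show 0 < 2 by norm_num)
    rwa [Cobordism.cutLevel_zero] at this
  have ht₀t₁ : t₀ < t₁ := Cobordism.cutLevel_strictMono 4 (by norm_num)
  have ht₁1 : t₁ < 1 := by
    have := Cobordism.cutLevel_strictMono 4 (show 3 < 4 + 2 by norm_num)
    rwa [Cobordism.cutLevel_eq_one] at this
  have hνt : ∀ j m, Cobordism.niceLevel 4 j ≠ Cobordism.cutLevel 4 m := Cobordism.niceLevel_ne_cutLevel 4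
  obtain ⟨ξ, hξ⟩ := Cobordism.Milnor1965_exists_isGradientLike_holds (c := d) hgM
  -- `K = g⁻¹[0, 1]` is simply connected
  have hK : IsSimplyConnected (g ⁻¹' Icc (0 : ℝ) 1) := by
    have : g ⁻¹' Icc (0 : ℝ) 1 = univ := eq_univ_of_forall fun z => hgM.mem_Icc z
    rw [this]
    exact (Homeomorph.Set.univ d.W).toHomotopyEquiv.simplyConnectedSpace_iff.2 inferInstance
  -- turning about: `g⁻¹[t₀, 1] = (1 - g)⁻¹[0, 1 - t₀]` is simply connected
  have hg' : d.symm.IsMorseFunction (fun z => 1 - g z) := hgM.symm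
  have hξ' : IsGradientLike (𝓡∂ (4 + 1)) (fun z => 1 - g z) (⇑(-ξ)) := by
    rw [ContMDiffSection.coe_neg]
    exact hgM.isGradientLike_const_sub_neg hξ 1
  have hcrit' := hgM.criticalSet_one_sub
  have hsetK : (fun z => 1 - g z) ⁻¹' Icc (0 : ℝ) 1 = g ⁻¹' Icc (0 : ℝ) 1 := by
    ext z; simp only [mem_preimage, mem_Icc]; constructor <;> rintro ⟨h1, h2⟩ <;> constructor <;> linarith
  have hK' : IsSimplyConnected ((fun z => 1 - g z) ⁻¹' Icc (0 : ℝ) 1) := by rw [hsetK]; exact hK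
  have hreg' : ∀ z ∈ criticalSet (𝓡∂ (4 + 1)) (fun z => 1 - g z), 1 - g z ≠ 1 - t₀ ∧ 1 - g z ≠ 1 := by
    intro z hz
    have hz : z ∈ criticalSet (𝓡∂ (4 + 1)) g := (Set.ext_iff.1 hcrit' z).1 hz
    refine ⟨fun h => ?_, fun h => ?_⟩
    · have : g z = t₀ := by linarith
      rw [hg.2 z hz] at this
      exact hνt _ _ this
    · have : g z = 0 := by linarith
      exact (hgM.apply_mem_Ioo_of_mem_criticalSet hz).1.ne' this
  have hstep₁ := (Cobordism.isSimplyConnected_slab_left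
    Cobordism.Milnor1965_deformationRetract_leftHandDiscs_holds
    Cobordism.Milnor1965_leftHandDisc_isDisc_holds hg' (-ξ) hξ' (a := 0) (t := 1 - t₀) (b := 1)
    le_rfl (by linarith) (by linarith) le_rfl hreg').2
    (fun z hz hzI => by
      have hz : z ∈ criticalSet (𝓡∂ (4 + 1)) g := (Set.ext_iff.1 hcrit' z).1 hz
      exfalso
      have h1 : g z < t₀ := by linarith [hzI.1]
      exact absurd h1 (not_lt.2 (hg.cutLevel_two_lt_apply h2 hz).le)) hK'
  have hset₁ : (fun z => 1 - g z) ⁻¹' Icc (0 : ℝ) (1 - t₀) = g ⁻¹' Icc t₀ 1 := by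
    ext z; simp only [mem_preimage, mem_Icc]; constructor <;> rintro ⟨h1, h2⟩ <;> constructor <;> linarith
  have hslab₁ : IsSimplyConnected (g ⁻¹' Icc t₀ 1) := by rw [← hset₁]; exact hstep₁
  -- cutting off the top: only critical points of index `≥ 3` above `t₁`
  have hreg : ∀ z ∈ criticalSet (𝓡∂ (4 + 1)) g, g z ≠ t₁ ∧ g z ≠ 1 := fun z hz => by
    refine ⟨by rw [hg.2 z hz]; exact hνt _ _, (hgM.apply_mem_Ioo_of_mem_criticalSet hz).2.ne⟩
  exact (Cobordism.isSimplyConnected_slab_left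
    Cobordism.Milnor1965_deformationRetract_leftHandDiscs_holds
    Cobordism.Milnor1965_leftHandDisc_isDisc_holds hgM ξ hξ ht0.le ht₀t₁.le ht₁1 le_rfl hreg).2
    (fun z hz hzI => by
      by_contra hlt
      have hidx : morseIndex (𝓡∂ (4 + 1)) g z = 2 := by have := h2 z hz; omega
      have hval := hg.2 z hz
      rw [hidx] at hval
      have := Cobordism.niceLevel_lt_cutLevel_succ 4 2
      rw [← hval] at this
      exact absurd hzI.1 (not_lt.2 this.le)) hslab₁

end Connected

/-! ### The program: Thm. 7.6 on the index-2 slab, the lowering of the homological points,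
and the acyclic top part -/

section Main

variable {V P : Type u} [TopologicalSpace V] [T2Space V] [SecondCountableTopology V]
  [ChartedSpace (𝔼 4) V] [IsManifold (𝓡 4) ∞ V] [CompactSpace V]
  [TopologicalSpace P] [T2Space P] [SecondCountableTopology P] [ChartedSpace (𝔼 4) P]
  [IsManifold (𝓡 4) ∞ P] [CompactSpace P]

set_option maxHeartbeats 1600000 in
-- the assembly keeps a couple of hundred hypotheses in context
/-- **Wall 1964, Lemma 2 in Morse form on the cobordism `K`** (the module docstring displays the
argument, items 1–4): GIVEN the Basis Theorem 7.6 on a slab, a 5-dimensional cobordism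
`(K; V, P)` with `K`, `V` simply connected, `H₀(K, V) = 0`, `Hᵢ(K, V; ℤ) = 0` for `i ≠ 2` and
`H₂(K, V; ℤ)` free of rank `k` carries a Morse function `g` with all indices `≥ 2` and a
non-critical level `m ∈ (0, 1)` below which lie exactly `k` critical points, all of index `2`,
and above which the sublevel pair is acyclic: `H⁎({g ≤ 1}, {g ≤ m}; ℤ) = 0`.
[cite: WallJLMS1964, Lemma 2 and its proof (pp. 143–144)] [cite: MilnorHCobordism1965, Thm. 2.5, Cor. 3.15, Thms. 4.1, 4.2, 4.8, 7.6, 8.1 (PDF pp. 6–57)] -/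
theorem Cobordism.exists_isMorseFunction_sublevel_acyclic
    (h76 : Cobordism.Milnor1965_basisTheorem_slab.{u})
    (d : Cobordism 4 V P) [SimplyConnectedSpace d.W] [SimplyConnectedSpace V]
    (hH0 : ∀ z : d.W, ∃ x, Joined z (d.inl x)) {k : ℕ}
    [Module.Free ℤ (relativeSingularHomology ℤ ℤ d.W (range d.inl) 2)]
    [Module.Finite ℤ (relativeSingularHomology ℤ ℤ d.W (range d.inl) 2)]
    (hrank : Module.finrank ℤ (relativeSingularHomology ℤ ℤ d.W (range d.inl) 2) = k)
    (hzero : ∀ i, i ≠ 2 → IsZero (relativeSingularHomology ℤ ℤ d.W (range d.inl) i)) :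
    ∃ (g : d.W → ℝ) (m : ℝ), d.IsMorseFunction g ∧
      (∀ z ∈ criticalSet (𝓡∂ (4 + 1)) g, 2 ≤ morseIndex (𝓡∂ (4 + 1)) g z) ∧
      m ∈ Ioo (0 : ℝ) 1 ∧ (∀ z ∈ criticalSet (𝓡∂ (4 + 1)) g, g z ≠ m) ∧
      (∀ z ∈ criticalSet (𝓡∂ (4 + 1)) g, g z < m → morseIndex (𝓡∂ (4 + 1)) g z = 2) ∧
      (criticalSet (𝓡∂ (4 + 1)) g ∩ g ⁻¹' Iio m).ncard = k ∧
      ∀ i, IsZero (sublevelHomology g m 1 i) := by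
  classical
  obtain ⟨g, hg, h2⟩ := d.exists_isNiceMorseFunction_two_le_index hH0
  have hgM : d.IsMorseFunction g := hg.1
  have hgd : MDifferentiable (𝓡∂ (4 + 1)) 𝓘(ℝ, ℝ) g := hgM.isMorse.contMDiff.mdifferentiable (by simp)
  ----------------------------------------------------------------------------------------------
  -- Levels `0 < t₀ < ν < t₁ < 1`.
  ----------------------------------------------------------------------------------------------
  set t₀ : ℝ := Cobordism.cutLevel 4 2 with ht₀d
  set t₁ : ℝ := Cobordism.cutLevel 4 3 with ht₁d
  set ν : ℝ := Cobordism.niceLevel 4 2 with hνd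
  have ht0 : 0 < t₀ := by
    have := Cobordism.cutLevel_strictMono 4 (show 0 < 2 by norm_num)
    rwa [Cobordism.cutLevel_zero] at this
  have ht₀ν : t₀ < ν := Cobordism.cutLevel_lt_niceLevel 4 2
  have hνt₁ : ν < t₁ := Cobordism.niceLevel_lt_cutLevel_succ 4 2
  have ht₁1 : t₁ < 1 := by
    have := Cobordism.cutLevel_strictMono 4 (show 3 < 4 + 2 by norm_num)
    rwa [Cobordism.cutLevel_eq_one] at this
  have ht₀t₁ : t₀ < t₁ := ht₀ν.trans hνt₁
  have hνt : ∀ j m, Cobordism.niceLevel 4 j ≠ Cobordism.cutLevel 4 m := Cobordism.niceLevel_ne_cutLevel 4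
  have hcritk : ∀ z ∈ criticalSet (𝓡∂ (4 + 1)) g, g z ∈ Icc t₀ t₁ →
      g z = ν ∧ morseIndex (𝓡∂ (4 + 1)) g z = 2 :=
    fun z hz hzI => hg.eq_of_apply_mem_Icc_cutLevel hz hzI
  have hregg : ∀ z ∈ criticalSet (𝓡∂ (4 + 1)) g, g z ≠ t₀ ∧ g z ≠ t₁ := fun z hz => by
    rw [hg.2 z hz]; exact ⟨hνt _ _, hνt _ _⟩
  -- a critical point is either in the index-2 slab or above `t₁`
  have habove : ∀ z ∈ criticalSet (𝓡∂ (4 + 1)) g, g z ∈ Icc t₀ t₁ ∨ t₁ < g z := by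
    intro z hz
    have hval := hg.2 z hz
    by_cases hidx : morseIndex (𝓡∂ (4 + 1)) g z = 2
    · left; rw [hval, hidx]; exact ⟨ht₀ν.le, hνt₁.le⟩
    · right
      have h3 : 3 ≤ morseIndex (𝓡∂ (4 + 1)) g z := by have := h2 z hz; omega
      rw [hval]
      exact (Cobordism.cutLevel_lt_niceLevel 4 3).trans_le ((Cobordism.niceLevel_strictMono 4).monotone h3)
  ----------------------------------------------------------------------------------------------
  -- The homology: `Q = H₂(K^1, K^{t₀}) ≅ H₂(K, V)` free of rank `k`, `C₂ → Q` onto, adapted basis.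
  ----------------------------------------------------------------------------------------------
  have hX : ∀ i, i ≠ 2 → IsZero (sublevelHomology g t₀ 1 i) :=
    fun i hi => hg.isZero_sublevelHomology_cutLevel_two_one h2 hzero hi
  let eQ := (hg.sublevelTwoIso h2).toLinearEquiv
  haveI hQfree : Module.Free ℤ (sublevelHomology g t₀ 1 2) := Module.Free.of_equiv eQ.symm
  haveI hQfin : Module.Finite ℤ (sublevelHomology g t₀ 1 2) := Module.Finite.equiv eQ.symm
  have hrankQ : Module.finrank ℤ (sublevelHomology g t₀ 1 2) = k := by rw [eQ.finrank_eq, hrank]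
  let bQ : Module.Basis (Fin k) ℤ (sublevelHomology g t₀ 1 2) := Module.finBasisOfFinrankEq ℤ _ hrankQ
  obtain ⟨hCc, hCfree, hCfin, hCrk⟩ :=
    Cobordism.Milnor1965_homology_oneLevel_slab_holds hgM ht0.le ht₀ν hνt₁ ht₁1.le hcritk
  set j := sublevelMap g t₀ ht₁1.le 2 with hjd
  have hjsurj : Function.Surjective j.hom := by
    haveI : Epi j := (sublevel_exact₂ g ht₀t₁.le ht₁1.le 2).epi_f
      ((hg.isZero_sublevelHomology_cutLevel_three_one le_rfl).eq_of_tgt _ _)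
    exact (ModuleCat.epi_iff_surjective _).mp inferInstance
  haveI := hCfree; haveI := hCfin
  obtain ⟨m', bP, hker, hlift⟩ := exists_basis_map_natAdd_eq bQ j.hom hjsurj
  ----------------------------------------------------------------------------------------------
  -- Thm. 7.6 on the index-2 slab.
  ----------------------------------------------------------------------------------------------
  obtain ⟨ξ, hξ⟩ := Cobordism.Milnor1965_exists_isGradientLike_holds (c := d) hgM
  have hconn : IsConnected (g ⁻¹' Icc t₀ t₁) :=
    (hg.isSimplyConnected_slab_two h2).isPathConnected.isConnected
  haveI hΦ := Cobordism.Milnor1965_slabHomology_iso_holds hgM ht0 ht₀t₁ hregg 2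
  set eθ := bP.map (asIso (relativeSingularHomology.map ℤ ℤ (slabToSublevel g t₀ t₁)
    (mapsTo_slabToSublevel g t₀ t₁) 2)).toLinearEquiv.symm with heθd
  obtain ⟨g', ξ', hg', hξ', hnear₁, hin₁, hcrit₁, hind₁, ⟨b₁, hb₁, hlev₁⟩, σ, hσ, hσr, hdisc₁'⟩ :=
    h76 hgM ξ hξ ht0.le ht₀ν hνt₁ ht₁1.le le_rfl (by norm_num) hcritk hconn eθ
  have hdisc₁ : ∀ i, ∃ (h₁ : leftHandDisc (𝓡∂ (4 + 1)) g' ξ' (σ i) t₀ ⊆ {z | g z ≤ t₁})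
      (h₀ : MapsTo (Set.inclusion h₁)
        (Subtype.val ⁻¹' leftHandSphere (𝓡∂ (4 + 1)) g' ξ' (σ i) t₀)
        {z : ↥{z : d.W | g z ≤ t₁} | g z.1 ≤ t₀}),
      ∃ γ, (relativeSingularHomology.map ℤ ℤ
        (⟨Set.inclusion h₁, continuous_inclusion h₁⟩ :
          C(↥(leftHandDisc (𝓡∂ (4 + 1)) g' ξ' (σ i) t₀), ↥{z : d.W | g z ≤ t₁})) h₀ 2).hom γ =
        bP i := by
    intro i
    obtain ⟨h₁, h₀, γ, hγ⟩ := hdisc₁' i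
    obtain ⟨h₁', h₀', h⟩ := exists_map_sublevel_eq_of_map_slab_eq g 2 h₁ h₀ (bP i) (γ := γ)
      (by rw [hγ, heθd, Module.Basis.map_apply])
    exact ⟨h₁', h₀', γ, h⟩
  have heq₁ : ∀ z, g z ∉ Ioo t₀ t₁ → g' z = g z := fun z hz => (hnear₁.self_of_nhdsSet z hz).1
  have hα₀ : ∀ z, g z ≤ t₀ ↔ g' z ≤ t₀ := le_iff_le_of_alteration heq₁ hin₁ (Or.inl le_rfl)
  have hα₁ : ∀ z, g z ≤ t₁ ↔ g' z ≤ t₁ := le_iff_le_of_alteration heq₁ hin₁ (Or.inr le_rfl)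
  have hα1 : ∀ z, g z ≤ 1 ↔ g' z ≤ 1 := le_iff_le_of_alteration heq₁ hin₁ (Or.inr ht₁1.le)
  have hαI₁ : ∀ z, g z ∈ Icc t₀ t₁ ↔ g' z ∈ Icc t₀ t₁ :=
    mem_Icc_iff_of_alteration_of_subset heq₁ hin₁ Ioo_subset_Icc_self
  have hσcrit : ∀ z ∈ range σ, z ∈ criticalSet (𝓡∂ (4 + 1)) g ∧ g z ∈ Icc t₀ t₁ := fun z hz => by
    rw [hσr] at hz; exact hz
  have hv1 : ContMDiff (𝓡∂ (4 + 1)) (𝓡∂ (4 + 1)).tangent 1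
      (fun y ↦ (⟨y, ξ' y⟩ : TangentBundle (𝓡∂ (4 + 1)) d.W)) :=
    ξ'.contMDiff.of_le (WithTop.coe_le_coe.mpr le_top)
  have hg'd : MDifferentiable (𝓡∂ (4 + 1)) 𝓘(ℝ, ℝ) g' := hg'.isMorse.contMDiff.mdifferentiable (by simp)
  -- the homological points (last `k`) and the kernel points (first `m'`)
  set Pg : Set d.W := range (fun i : Fin k => σ (Fin.natAdd m' i)) with hPgd
  set Pk : Set d.W := range (fun j : Fin m' => σ (Fin.castAdd k j)) with hPkd
  have hPgσ : Pg ⊆ range σ := by rintro _ ⟨i, rfl⟩; exact ⟨_, rfl⟩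
  have hPkσ : Pk ⊆ range σ := by rintro _ ⟨j, rfl⟩; exact ⟨_, rfl⟩
  have hPunion : Pg ∪ Pk = range σ := by
    refine Subset.antisymm (union_subset hPgσ hPkσ) ?_
    rintro _ ⟨l, rfl⟩
    refine Fin.addCases (motive := fun l => σ l ∈ Pg ∪ Pk) (fun j => ?_) (fun i => ?_) l
    · exact Or.inr ⟨j, rfl⟩
    · exact Or.inl ⟨i, rfl⟩
  have hPdisj : Disjoint Pg Pk := by
    refine disjoint_left.2 ?_
    rintro _ ⟨i, rfl⟩ ⟨j, hj⟩
    have := hσ hj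
    exact absurd (congrArg Fin.val this) (by simp [Fin.val_natAdd, Fin.val_castAdd]; omega)
  have hval'σ : ∀ z ∈ range σ, g' z = b₁ := fun z hz =>
    hlev₁ z (hσcrit z hz).1 (hσcrit z hz).2
  ----------------------------------------------------------------------------------------------
  -- The common conclusion, for any function `g₄` lowering `Pg` below `mid` and keeping `Pk`
  -- above it (and for `g'` itself when one of the two sets is empty).
  ----------------------------------------------------------------------------------------------
  have key : ∀ (g₄ : d.W → ℝ) (mid αl : ℝ), d.IsMorseFunction g₄ → IsGradientLike (𝓡∂ (4 + 1)) g₄ ξ' →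
      criticalSet (𝓡∂ (4 + 1)) g₄ = criticalSet (𝓡∂ (4 + 1)) g' →
      (∀ z ∈ criticalSet (𝓡∂ (4 + 1)) g', morseIndex (𝓡∂ (4 + 1)) g₄ z = morseIndex (𝓡∂ (4 + 1)) g' z) →
      (∀ z, g' z ∉ Ioo t₀ t₁ → g₄ z = g' z) → (∀ z, g' z ∈ Ioo t₀ t₁ → g₄ z ∈ Ioo t₀ t₁) →
      mid ∈ Ioo t₀ t₁ → αl ∈ Ioo t₀ mid → (∀ z ∈ Pg, g₄ z = αl) → (∀ z ∈ Pk, mid < g₄ z) →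
      ∃ (g : d.W → ℝ) (m : ℝ), d.IsMorseFunction g ∧
        (∀ z ∈ criticalSet (𝓡∂ (4 + 1)) g, 2 ≤ morseIndex (𝓡∂ (4 + 1)) g z) ∧
        m ∈ Ioo (0 : ℝ) 1 ∧ (∀ z ∈ criticalSet (𝓡∂ (4 + 1)) g, g z ≠ m) ∧
        (∀ z ∈ criticalSet (𝓡∂ (4 + 1)) g, g z < m → morseIndex (𝓡∂ (4 + 1)) g z = 2) ∧
        (criticalSet (𝓡∂ (4 + 1)) g ∩ g ⁻¹' Iio m).ncard = k ∧
        ∀ i, IsZero (sublevelHomology g m 1 i) := by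
    intro g₄ mid αl hg₄ hξ₄ hcrit₄ hind₄ heq₄ hin₄ hmid hαl hPg₄ hPk₄
    have hg₄d : MDifferentiable (𝓡∂ (4 + 1)) 𝓘(ℝ, ℝ) g₄ := hg₄.isMorse.contMDiff.mdifferentiable (by simp)
    -- the sublevel sets at `t₀`, `t₁`, `1` are those of `g`
    have hβ₀ : ∀ z, g' z ≤ t₀ ↔ g₄ z ≤ t₀ := le_iff_le_of_alteration heq₄ hin₄ (Or.inl le_rfl)
    have hβ1 : ∀ z, g' z ≤ 1 ↔ g₄ z ≤ 1 := le_iff_le_of_alteration heq₄ hin₄ (Or.inr ht₁1.le)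
    have hA₀ : ∀ z, g z ≤ t₀ ↔ g₄ z ≤ t₀ := fun z => (hα₀ z).trans (hβ₀ z)
    have hA1 : ∀ z, g z ≤ 1 ↔ g₄ z ≤ 1 := fun z => (hα1 z).trans (hβ1 z)
    have hcritg₄ : criticalSet (𝓡∂ (4 + 1)) g₄ = criticalSet (𝓡∂ (4 + 1)) g := hcrit₄.trans hcrit₁
    have hindg₄ : ∀ z ∈ criticalSet (𝓡∂ (4 + 1)) g,
        morseIndex (𝓡∂ (4 + 1)) g₄ z = morseIndex (𝓡∂ (4 + 1)) g z := fun z hz => by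
      rw [hind₄ z (by rw [hcrit₁]; exact hz), hind₁ z hz]
    -- master description of the critical points of `g₄`
    have hmaster : ∀ z ∈ criticalSet (𝓡∂ (4 + 1)) g₄,
        (z ∈ Pg ∧ g₄ z = αl) ∨ (z ∈ Pk ∧ mid < g₄ z ∧ g₄ z < t₁) ∨ (t₁ < g₄ z ∧ g₄ z = g z) := by
      intro z hz
      rw [hcritg₄] at hz
      rcases habove z hz with hzI | hzI
      · have hzσ : z ∈ range σ := by rw [hσr]; exact ⟨hz, hzI⟩
        rw [← hPunion] at hzσ
        rcases hzσ with hzg | hzk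
        · exact Or.inl ⟨hzg, hPg₄ z hzg⟩
        · refine Or.inr (Or.inl ⟨hzk, hPk₄ z hzk, ?_⟩)
          have h1 : g' z = b₁ := hval'σ z (hPkσ hzk)
          exact (hin₄ z (by rw [h1]; exact hb₁)).2
      · have h1 : g' z = g z := heq₁ z fun h => lt_asymm h.2 hzI
        have h4 : g₄ z = g' z := heq₄ z (by rw [h1]; exact fun h => lt_asymm h.2 hzI)
        exact Or.inr (Or.inr ⟨by rw [h4, h1]; exact hzI, by rw [h4, h1]⟩)
    -- Cor. 3.15 on the slab `[t₀, mid]`: the `k` homological points, of index `2`, on `αl`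
    have hcritA : ∀ z ∈ criticalSet (𝓡∂ (4 + 1)) g₄, g₄ z ∈ Icc t₀ mid →
        g₄ z = αl ∧ morseIndex (𝓡∂ (4 + 1)) g₄ z = 2 := by
      intro z hz hzI
      rcases hmaster z hz with ⟨hzg, hv⟩ | ⟨-, hv, -⟩ | ⟨hv, -⟩
      · refine ⟨hv, ?_⟩
        have hzc : z ∈ criticalSet (𝓡∂ (4 + 1)) g := by rw [← hcritg₄]; exact hz
        rw [hindg₄ z hzc]
        exact (hcritk z hzc (hσcrit z (hPgσ hzg)).2).2
      · exfalso; linarith [hzI.2]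
      · exfalso; linarith [hzI.2, hmid.2]
    have hsetA : criticalSet (𝓡∂ (4 + 1)) g₄ ∩ g₄ ⁻¹' Icc t₀ mid = Pg := by
      ext z
      simp only [mem_inter_iff, mem_preimage]
      constructor
      · rintro ⟨hz, hzI⟩
        rcases hmaster z hz with ⟨hzg, -⟩ | ⟨-, hv, -⟩ | ⟨hv, -⟩
        · exact hzg
        · exfalso; linarith [hzI.2]
        · exfalso; linarith [hzI.2, hmid.2]
      · intro hzg
        have hzc := (hσcrit z (hPgσ hzg)).1
        refine ⟨by rw [hcritg₄]; exact hzc, ?_⟩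
        rw [hPg₄ z hzg]; exact ⟨hαl.1.le, hαl.2.le⟩
    obtain ⟨hAc, hAfree, hAfin, hArk⟩ :=
      Cobordism.Milnor1965_homology_oneLevel_slab_holds hg₄ ht0.le hαl.1 hαl.2
        (hmid.2.le.trans ht₁1.le) hcritA
    rw [hsetA] at hArk
    have hPgcard : Pg.ncard = k := by
      rw [hPgd, Set.ncard_range_of_injective, Nat.card_eq_fintype_card, Fintype.card_fin]
      intro i i' h
      simpa using hσ h
    rw [hPgcard] at hArk
    -- the homology above `t₀` for `g₄` is that for `g`
    have hX₄ : ∀ i, i ≠ 2 → IsZero (sublevelHomology g₄ t₀ 1 i) := fun i hi =>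
      (hX i hi).of_iso (sublevelCongrIso hA₀ hA1 i).symm
    let eX := (sublevelCongrIso hA₀ hA1 2).toLinearEquiv
    haveI hX₄free : Module.Free ℤ (sublevelHomology g₄ t₀ 1 2) := Module.Free.of_equiv eX
    haveI hX₄fin : Module.Finite ℤ (sublevelHomology g₄ t₀ 1 2) := Module.Finite.equiv eX
    have hrankX₄ : Module.finrank ℤ (sublevelHomology g₄ t₀ 1 2) = k := by
      rw [← eX.finrank_eq, hrankQ]
    -- the map `H₂(K₄^{mid}, K₄^{t₀}) → H₂(K₄^1, K₄^{t₀})` hits the basis `eX (bQ i)`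
    have hmid1 : mid ≤ 1 := hmid.2.le.trans ht₁1.le
    have hhit : ∀ i : Fin k, ∃ x : sublevelHomology g₄ t₀ mid 2,
        (sublevelMap g₄ t₀ hmid1 2).hom x = eX (bQ i) := by
      intro i
      obtain ⟨hD₁, hD₀, γ, hγ⟩ := hdisc₁ (Fin.natAdd m' i)
      have hpg : σ (Fin.natAdd m' i) ∈ Pg := ⟨i, rfl⟩
      -- the disc lies in `{g₄ ≤ mid}`, its sphere in `{g₄ ≤ t₀}`
      have hDA : ∀ y ∈ leftHandDisc (𝓡∂ (4 + 1)) g' ξ' (σ (Fin.natAdd m' i)) t₀, g₄ y ≤ mid := by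
        intro y hy
        have := hξ₄.apply_le_of_mem_stableSet hg₄d hy.1
        rw [hPg₄ _ hpg] at this
        exact this.trans hαl.2.le
      have hSA : ∀ y ∈ leftHandSphere (𝓡∂ (4 + 1)) g' ξ' (σ (Fin.natAdd m' i)) t₀, g₄ y ≤ t₀ := by
        intro y hy
        have h2' : g' y = t₀ := hy.2
        have : g₄ y = g' y := heq₄ y (by rw [h2']; exact fun h => lt_irrefl _ h.1)
        rw [this, h2']
      set F : C(↥(leftHandDisc (𝓡∂ (4 + 1)) g' ξ' (σ (Fin.natAdd m' i)) t₀), ↥{z : d.W | g z ≤ t₁}) :=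
        ⟨Set.inclusion hD₁, continuous_inclusion hD₁⟩ with hFd
      set F₄ : C(↥(leftHandDisc (𝓡∂ (4 + 1)) g' ξ' (σ (Fin.natAdd m' i)) t₀), ↥{z : d.W | g₄ z ≤ mid}) :=
        ⟨fun y => ⟨y.1, hDA y.1 y.2⟩, by fun_prop⟩ with hF₄d
      have hF₄ : MapsTo F₄ (Subtype.val ⁻¹' leftHandSphere (𝓡∂ (4 + 1)) g' ξ' (σ (Fin.natAdd m' i)) t₀)
          {z : ↥{z : d.W | g₄ z ≤ mid} | g₄ z.1 ≤ t₀} := fun y hy => hSA y.1 hy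
      refine ⟨(relativeSingularHomology.map ℤ ℤ F₄ hF₄ 2).hom γ, ?_⟩
      -- `sublevelMap ∘ map F₄ = sublevelCongr ∘ sublevelMap_g ∘ map F`
      have hcomp : relativeSingularHomology.map ℤ ℤ F₄ hF₄ 2 ≫ sublevelMap g₄ t₀ hmid1 2 =
          relativeSingularHomology.map ℤ ℤ F hD₀ 2 ≫ sublevelMap g t₀ ht₁1.le 2 ≫
            sublevelCongr hA₀ hA1 2 := by
        rw [sublevelMap, sublevelMap, ← relativeSingularHomology.map_comp,
          ← relativeSingularHomology.map_comp_assoc, map_comp_sublevelCongr]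
        exact relativeSingularHomology.map_congr ℤ ℤ (by ext y; rfl) _ _ _
      have := congrArg (fun φ => (ModuleCat.Hom.hom φ) γ) hcomp
      simp only [ModuleCat.hom_comp, LinearMap.comp_apply] at this
      rw [this, hγ]
      change (sublevelCongr hA₀ hA1 2).hom (j.hom (bP (Fin.natAdd m' i))) = eX (bQ i)
      rw [hlift i]
      rfl
    have hsurj₄ : Function.Surjective (sublevelMap g₄ t₀ hmid1 2).hom := by
      rw [← LinearMap.range_eq_top, eq_top_iff, ← (bQ.map eX).span_eq, Submodule.span_le]
      rintro _ ⟨i, rfl⟩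
      obtain ⟨x, hx⟩ := hhit i
      rw [Module.Basis.map_apply]
      exact ⟨x, hx⟩
    haveI := hAfree; haveI := hAfin
    have hvan : ∀ i, IsZero (sublevelHomology g₄ mid 1 i) :=
      isZero_sublevelHomology_of_surjective_of_finrank_eq g₄ (hαl.1.le.trans hαl.2.le)
        hmid1 hAc hX₄ (hArk.trans hrankX₄.symm) hsurj₄
    -- the output
    refine ⟨g₄, mid, hg₄, fun z hz => ?_, ⟨ht0.trans hmid.1, hmid.2.trans ht₁1⟩, fun z hz => ?_,
      fun z hz hzm => ?_, ?_, hvan⟩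
    · rw [hcritg₄] at hz; rw [hindg₄ z hz]; exact h2 z hz
    · rcases hmaster z hz with ⟨-, hv⟩ | ⟨-, hv, -⟩ | ⟨hv, -⟩
      · rw [hv]; exact hαl.2.ne
      · exact hv.ne'
      · exact ((hmid.2.trans hv)).ne'
    · rcases hmaster z hz with ⟨hzg, -⟩ | ⟨-, hv, -⟩ | ⟨hv, -⟩
      · have hzc : z ∈ criticalSet (𝓡∂ (4 + 1)) g := by rw [← hcritg₄]; exact hz
        rw [hindg₄ z hzc]; exact (hcritk z hzc (hσcrit z (hPgσ hzg)).2).2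
      · exfalso; linarith
      · exfalso; linarith [hmid.2]
    · have : criticalSet (𝓡∂ (4 + 1)) g₄ ∩ g₄ ⁻¹' Iio mid = Pg := by
        rw [← hsetA]
        ext z
        simp only [mem_inter_iff, mem_preimage, mem_Iio, mem_Icc]
        constructor
        · rintro ⟨hz, hzm⟩
          refine ⟨hz, ?_, hzm.le⟩
          rw [hcritg₄] at hz
          exact ((hA₀ z).not.1 (not_le.2 ((hg.cutLevel_two_lt_apply h2 hz)))) |> not_le.1 |>.le
        · rintro ⟨hz, -, hzm⟩
          refine ⟨hz, lt_of_le_of_ne hzm ?_⟩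
          rcases hmaster z hz with ⟨-, hv⟩ | ⟨-, hv, -⟩ | ⟨hv, -⟩
          · rw [hv]; exact hαl.2.ne
          · exact hv.ne'
          · exact (hmid.2.trans hv).ne'
      rw [this, hPgcard]
  ----------------------------------------------------------------------------------------------
  -- The three cases: `k = 0`; `m' = 0`; and the rearrangement 4.2 when both sets are nonempty.
  ----------------------------------------------------------------------------------------------
  by_cases hk : k = 0
  · -- no homological point: `mid` below the common level `b₁`
    subst hk
    refine key g' ((t₀ + b₁) / 2) ((3 * t₀ + b₁) / 4) hg' hξ' rfl (fun z _ => rfl) (fun z _ => rfl)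
      (fun z hz => hz) ⟨by linarith [hb₁.1], by linarith [hb₁.2]⟩ ⟨by linarith [hb₁.1], by linarith [hb₁.1]⟩
      ?_ ?_
    · rintro _ ⟨i, rfl⟩; exact i.elim0
    · intro z hz; rw [hval'σ z (hPkσ hz)]; linarith [hb₁.1]
  by_cases hm' : m' = 0
  · -- no kernel point: `mid` above the common level `b₁`
    subst hm'
    refine key g' ((b₁ + t₁) / 2) b₁ hg' hξ' rfl (fun z _ => rfl) (fun z _ => rfl) (fun z hz => hz)
      ⟨by linarith [hb₁.1], by linarith [hb₁.2]⟩ ⟨hb₁.1, by linarith [hb₁.2]⟩ ?_ ?_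
    · intro z hz; exact hval'σ z (hPgσ hz)
    · rintro _ ⟨j, rfl⟩; exact j.elim0
  -- both nonempty: lower `Pg` to `α`, keep `Pk` on `b₁` (Thm. 4.2 on the slab)
  have hPgne : Pg.Nonempty := ⟨σ (Fin.natAdd m' ⟨0, Nat.pos_of_ne_zero hk⟩), ⟨_, rfl⟩⟩
  have hPkne : Pk.Nonempty := ⟨σ (Fin.castAdd k ⟨0, Nat.pos_of_ne_zero hm'⟩), ⟨_, rfl⟩⟩
  set α : ℝ := (t₀ + b₁) / 2 with hαd
  have hα : α ∈ Ioo t₀ t₁ := ⟨by rw [hαd]; linarith [hb₁.1], by rw [hαd]; linarith [hb₁.2]⟩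
  have hsub : Pg ∪ Pk ⊆ criticalSet (𝓡∂ (4 + 1)) g' := by
    rw [hPunion, hcrit₁]; exact fun z hz => (hσcrit z hz).1
  have hslab' : ∀ z ∈ criticalSet (𝓡∂ (4 + 1)) g', g' z ∈ Icc t₀ t₁ → z ∈ Pg ∪ Pk := by
    intro z hz hzI
    rw [hPunion, hσr]
    rw [hcrit₁] at hz
    exact ⟨hz, (hαI₁ z).2 hzI⟩
  have hK : Disjoint (⋃ z ∈ Pg, trajectorySet (𝓡∂ (4 + 1)) ξ' z)
      (⋃ z ∈ Pk, trajectorySet (𝓡∂ (4 + 1)) ξ' z) := by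
    refine disjoint_iUnion₂_left.2 fun z hz => disjoint_iUnion₂_right.2 fun z' hz' => ?_
    exact hξ'.disjoint_trajectorySet_of_apply_eq hv1 hg'd (fun h => hPdisj.ne_of_mem hz hz' h)
      ((hval'σ z (hPgσ hz)).trans (hval'σ z' (hPkσ hz')).symm)
  obtain ⟨g₄, hg₄, hξ₄, hcrit₄, hvP, hvP', hnear₄, hin₄, hlocP, hlocP'⟩ :=
    Cobordism.Milnor1965_rearrangement_slab_holds hg' ξ' hξ' ht0 ht₀t₁ ht₁1 hPgne hPkne hPdisj hsub
      hslab' hb₁ hb₁ (fun z hz => hval'σ z (hPgσ hz)) (fun z hz => hval'σ z (hPkσ hz)) hK hα hb₁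
  have heq₄ : ∀ z, g' z ∉ Ioo t₀ t₁ → g₄ z = g' z := fun z hz => hnear₄.self_of_nhdsSet z hz
  -- indices are kept: near each critical point `g₄` is `g'` plus a constant or equals `g'`
  have hind₄ : ∀ z ∈ criticalSet (𝓡∂ (4 + 1)) g',
      morseIndex (𝓡∂ (4 + 1)) g₄ z = morseIndex (𝓡∂ (4 + 1)) g' z := by
    intro z hz
    by_cases hzI : g' z ∈ Icc t₀ t₁
    · rcases hslab' z hz hzI with hzg | hzk
      · exact morseIndex_congr_of_eventuallyEq_add_const (hlocP z hzg)
      · exact morseIndex_congr_of_eventuallyEq_add_const (hlocP' z hzk)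
    · have hzo : z ∈ {z | g' z ∉ Ioo t₀ t₁} := fun h => hzI (Ioo_subset_Icc_self h)
      exact morseIndex_congr_of_eventuallyEq (hnear₄.filter_mono (nhds_le_nhdsSet hzo))
  exact key g₄ ((α + b₁) / 2) α hg₄ hξ₄ hcrit₄ hind₄ heq₄ hin₄
    ⟨by linarith [hα.1, hb₁.1], by linarith [hα.2, hb₁.2]⟩
    ⟨hα.1, by rw [hαd]; linarith [hb₁.1]⟩ hvP (fun z hz => by rw [hvP' z hz, hαd]; linarith [hb₁.1])

end Main

end Filtration

end Literature.Topology.FourManifolds
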